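import Mathlib
import Literature.Analysis.FluidPDE.ClassicalSolutionCalculus
import Literature.Analysis.FluidPDE.RapidDecayLemmas
import Literature.Analysis.FluidPDE.KNSSThm52Integrand
import Summits.NavierStokesRegularity.NavierStokesRegularity.Theses.QuasipotentialCoercivity
import HarnessLib

/-!
# `QuasipotentialCoercivity.ReachableAlongFlow` — every slice of a classical Leray–Hopf solution is
  reachable with one action and horizon (item stmt-NavierStokesRegularity-1447)

**Statement.** For `ν, T > 0` and a classical solution `(u, p)` of unforced Navier–Stokes on
`[0, T) × ℝ³`, Leray–Hopf from its rapidly decaying datum `u 0`, there are a horizon `τ > 0` and an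
action `a` such that every slice `u t`, `t ∈ [0, T)`, is REACHABLE: it is the value at some time
`T₁ ≥ 0` of a classical Leray–Hopf solution issued from the endpoint `w T₀` of a forced, uniformly
Schwartz, classical path `(w, q, g)` on `[0, T₀]` starting from rest (`w 0 = 0`) with
`∫₀^{T₀} ∫ |g|² ≤ a` and `T₀ + T₁ ≤ τ`.

PROOF (the planner's «free Lyapunov» construction, made definitional). The LINEAR RAMP
`w s := s • u 0` on `[0, 1]` (`T₀ = 1`, pressure `q = 0`) is a classical solution of Navier–Stokes
with the force it defines, `g s := ∂ₛw + (w·∇)w − νΔw = u 0 + s²(u 0·∇)u 0 − ν s Δ(u 0)`; it is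
divergence free (`u 0` is), uniformly Schwartz on `[0, 1]` (Leibniz bound for the iterated
derivatives of `(s, x) ↦ s • u₀ x`, `norm_iteratedFDeriv_smul_le`, with the rapid decay of every
`Dⁿ u 0`), starts from rest and ends at `u 0`; its force obeys `‖g s x‖ ≤ C (1 + ‖x‖)⁻²`, so
`∫₀¹ ∫ |g|² ≤ C² ∫ (1 + ‖x‖)⁻⁴ < ∞` (`finite_integral_one_add_norm`, with the tree's `norm_laplacian_le_three_mul`) — this is the action `a`. The
tail is the solution itself: `(T₂, v, p_v) := (T, u, p)` with `T₁ := t`, and `τ := 1 + T`.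

HONEST FRAMING: a bookkeeping construction showing the route's reachability notion is non-empty
along the flow; nothing here bears on the coercivity cruxes or on regularity.
-/

noncomputable section

set_option linter.dupNamespace false

namespace Summit.NavierStokesRegularity.NavierStokesRegularity.Theorems

open Set MeasureTheory Filter Topology Function InnerProductSpace Laplacian
open scoped RealInnerProductSpace ContDiff Laplacian ENNReal NNReal
open Literature.Analysis.FluidPDE

/-! ### The linear ramp `(s, x) ↦ s • u₀ x` is uniformly Schwartz on `[0, T₀]` -/

/-- **Uniform rapid decay of the linear ramp**: for a smooth rapidly decaying `u₀`, the space–time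
field `w s x := s • u₀ x` is uniformly Schwartz on `[0, T₀]` (Leibniz bound for the iterated
derivatives of a product, the time factor contributing at most `T₀ + 1`). [folklore] -/
theorem hasUniformRapidDecayOn_ramp {u₀ : EuclideanSpace ℝ (Fin 3) → EuclideanSpace ℝ (Fin 3)}
    (hu₀s : ContDiff ℝ ∞ u₀) (hu₀ : HasRapidSpatialDecay u₀) {T₀ : ℝ} (hT₀ : 0 < T₀) :
    HasUniformRapidDecayOn (Icc 0 T₀) (fun s x => s • u₀ x) := by
  intro n K
  choose Cd hCd using hu₀
  set f : ℝ × EuclideanSpace ℝ (Fin 3) → ℝ :=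
    ⇑(ContinuousLinearMap.fst ℝ ℝ (EuclideanSpace ℝ (Fin 3))) with hf
  set g : ℝ × EuclideanSpace ℝ (Fin 3) → EuclideanSpace ℝ (Fin 3) :=
    u₀ ∘ ⇑(ContinuousLinearMap.snd ℝ ℝ (EuclideanSpace ℝ (Fin 3))) with hg
  have hfs : ContDiff ℝ ∞ f := (ContinuousLinearMap.fst ℝ ℝ (EuclideanSpace ℝ (Fin 3))).contDiff
  have hgs : ContDiff ℝ ∞ g :=
    hu₀s.comp (ContinuousLinearMap.snd ℝ ℝ (EuclideanSpace ℝ (Fin 3))).contDiff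
  have hFeq : uncurry (fun (s : ℝ) (x : EuclideanSpace ℝ (Fin 3)) => s • u₀ x) =
      fun z => f z • g z := by
    funext z; rfl
  have hF : ContDiff ℝ ∞ (uncurry fun (s : ℝ) (x : EuclideanSpace ℝ (Fin 3)) => s • u₀ x) := by
    rw [hFeq]; exact hfs.smul hgs
  have hUD : UniqueDiffOn ℝ (Icc (0 : ℝ) T₀ ×ˢ (univ : Set (EuclideanSpace ℝ (Fin 3)))) :=
    (uniqueDiffOn_Icc hT₀).prod uniqueDiffOn_univ
  -- the time factor: `‖Dⁱ f‖ ≤ T₀ + 1` on the slab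
  have hfb : ∀ (i : ℕ) (z : ℝ × EuclideanSpace ℝ (Fin 3)), z.1 ∈ Icc (0 : ℝ) T₀ →
      ‖iteratedFDeriv ℝ i f z‖ ≤ T₀ + 1 := by
    intro i z hz
    rcases i with _ | k
    · rw [norm_iteratedFDeriv_zero, hf, ContinuousLinearMap.coe_fst', Real.norm_eq_abs,
        abs_of_nonneg hz.1]
      linarith [hz.2]
    · rw [← norm_iteratedFDeriv_fderiv]
      have hD : fderiv ℝ f = fun _ => ContinuousLinearMap.fst ℝ ℝ (EuclideanSpace ℝ (Fin 3)) := by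
        funext y; exact (ContinuousLinearMap.fst ℝ ℝ (EuclideanSpace ℝ (Fin 3))).fderiv
      rw [hD]
      rcases k with _ | k
      · rw [norm_iteratedFDeriv_zero]
        exact (ContinuousLinearMap.norm_fst_le ℝ ℝ (EuclideanSpace ℝ (Fin 3))).trans (by linarith)
      · rw [iteratedFDeriv_const_of_ne (by omega)]
        simp only [Pi.zero_apply, norm_zero]
        linarith
  -- the space factor: `‖Dʲ g (s, x)‖ ≤ ‖Dʲ u₀ x‖`
  have hgb : ∀ (j : ℕ) (z : ℝ × EuclideanSpace ℝ (Fin 3)),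
      ‖iteratedFDeriv ℝ j g z‖ ≤ ‖iteratedFDeriv ℝ j u₀ z.2‖ := by
    intro j z
    rw [hg, (ContinuousLinearMap.snd ℝ ℝ (EuclideanSpace ℝ (Fin 3))).iteratedFDeriv_comp_right
      hu₀s z (i := j) (by exact_mod_cast le_top)]
    refine (ContinuousMultilinearMap.norm_compContinuousLinearMap_le _ _).trans ?_
    have h1 : ∏ _i : Fin j, ‖ContinuousLinearMap.snd ℝ ℝ (EuclideanSpace ℝ (Fin 3))‖ ≤ 1 :=
      Finset.prod_le_one (fun _ _ => norm_nonneg _) fun _ _ =>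
        ContinuousLinearMap.norm_snd_le ℝ ℝ (EuclideanSpace ℝ (Fin 3))
    calc ‖iteratedFDeriv ℝ j u₀ ((ContinuousLinearMap.snd ℝ ℝ (EuclideanSpace ℝ (Fin 3))) z)‖ *
          ∏ _i : Fin j, ‖ContinuousLinearMap.snd ℝ ℝ (EuclideanSpace ℝ (Fin 3))‖
        ≤ ‖iteratedFDeriv ℝ j u₀ z.2‖ * 1 := mul_le_mul_of_nonneg_left h1 (norm_nonneg _)
      _ = ‖iteratedFDeriv ℝ j u₀ z.2‖ := mul_one _
  refine ⟨∑ i ∈ Finset.range (n + 1), (n.choose i : ℝ) * (T₀ + 1) * Cd (n - i) K,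
    fun t ht x => ?_⟩
  have hz : ((t, x) : ℝ × EuclideanSpace ℝ (Fin 3)) ∈
      Icc (0 : ℝ) T₀ ×ˢ (univ : Set (EuclideanSpace ℝ (Fin 3))) := ⟨ht, mem_univ _⟩
  rw [iteratedFDerivWithin_eq_iteratedFDeriv hUD (hF.contDiffAt.of_le (by exact_mod_cast le_top)) hz,
    hFeq]
  have hle := norm_iteratedFDeriv_smul_le hfs hgs (t, x) (n := n) (by exact_mod_cast le_top)
  calc (1 + ‖x‖) ^ K * ‖iteratedFDeriv ℝ n (fun z => f z • g z) (t, x)‖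
      ≤ (1 + ‖x‖) ^ K * ∑ i ∈ Finset.range (n + 1),
          (n.choose i : ℝ) * ‖iteratedFDeriv ℝ i f (t, x)‖ *
            ‖iteratedFDeriv ℝ (n - i) g (t, x)‖ :=
        mul_le_mul_of_nonneg_left hle (by positivity)
    _ = ∑ i ∈ Finset.range (n + 1), (n.choose i : ℝ) * ‖iteratedFDeriv ℝ i f (t, x)‖ *
          ((1 + ‖x‖) ^ K * ‖iteratedFDeriv ℝ (n - i) g (t, x)‖) := by
        rw [Finset.mul_sum]
        exact Finset.sum_congr rfl fun i _ => by ring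
    _ ≤ ∑ i ∈ Finset.range (n + 1), (n.choose i : ℝ) * (T₀ + 1) * Cd (n - i) K := by
        refine Finset.sum_le_sum fun i _ => ?_
        have h1 := hfb i (t, x) ht
        have h2 : (1 + ‖x‖) ^ K * ‖iteratedFDeriv ℝ (n - i) g (t, x)‖ ≤ Cd (n - i) K :=
          (mul_le_mul_of_nonneg_left (hgb _ _) (by positivity)).trans (hCd (n - i) K x)
        have h0 : 0 ≤ (1 + ‖x‖) ^ K * ‖iteratedFDeriv ℝ (n - i) g (t, x)‖ := by positivity
        exact mul_le_mul (mul_le_mul_of_nonneg_left h1 (by positivity)) h2 h0 (by positivity)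

/-! ### The linear ramp as a forced classical solution -/

/-- The one-sided time derivative of the ramp within `[0, 1]` is the datum. [folklore] -/
theorem timeDerivWithin_ramp (u₀ : EuclideanSpace ℝ (Fin 3) → EuclideanSpace ℝ (Fin 3)) {s : ℝ}
    (hs : s ∈ Icc (0 : ℝ) 1) (x : EuclideanSpace ℝ (Fin 3)) :
    timeDerivWithin (Icc 0 1) (fun (s : ℝ) (x : EuclideanSpace ℝ (Fin 3)) => s • u₀ x) s x = u₀ x := by
  show derivWithin (fun s : ℝ => s • u₀ x) (Icc 0 1) s = u₀ x
  have h : HasDerivWithinAt (fun s : ℝ => s • u₀ x) ((1 : ℝ) • u₀ x) (Icc 0 1) s :=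
    ((hasDerivAt_id s).smul_const (u₀ x)).hasDerivWithinAt
  rw [h.derivWithin (uniqueDiffOn_Icc zero_lt_one s hs), one_smul]

/-- **The ramp solves forced Navier–Stokes** on `[0, 1]` with zero pressure and the force it
defines, `g = ∂ₛw + (w·∇)w − νΔw`; it is divergence free because `u₀` is. [folklore] -/
theorem isClassicalNSSolutionOn_ramp {u₀ : EuclideanSpace ℝ (Fin 3) → EuclideanSpace ℝ (Fin 3)}
    (hu₀s : ContDiff ℝ ∞ u₀) (hdiv : VectorCalculus.IsDivFree u₀) (ν : ℝ) :
    IsClassicalNSSolutionOn (Icc 0 1) ν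
      (fun s x => timeDerivWithin (Icc 0 1)
          (fun (s : ℝ) (x : EuclideanSpace ℝ (Fin 3)) => s • u₀ x) s x +
        convect (fun y => s • u₀ y) (fun y => s • u₀ y) x - ν • (Δ (fun y => s • u₀ y)) x)
      (fun s x => s • u₀ x) (fun _ _ => (0 : ℝ)) where
  smooth_velocity := by
    show ContDiffOn ℝ ∞ (fun z : ℝ × EuclideanSpace ℝ (Fin 3) => z.1 • u₀ z.2) _
    exact (contDiff_fst.smul (hu₀s.comp contDiff_snd)).contDiffOn
  smooth_pressure := by
    show ContDiffOn ℝ ∞ (fun _ : ℝ × EuclideanSpace ℝ (Fin 3) => (0 : ℝ)) _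
    exact contDiffOn_const
  momentum := by
    intro t _ x
    beta_reduce
    rw [gradient_fun_const, sub_zero, add_sub_cancel]
  divFree := by
    intro t _ x
    have hd : DifferentiableAt ℝ u₀ x := (hu₀s.differentiable (by simp)).differentiableAt
    have h0 := hdiv x
    unfold VectorCalculus.divergence at h0 ⊢
    rw [fderiv_fun_const_smul hd t, ContinuousLinearMap.toLinearMap_smul, map_smul, h0, smul_zero]

/-- **Pointwise size of the ramp force**: `‖g(s, x)‖ ≤ C (1 + ‖x‖)⁻²` on `[0, 1] × ℝ³`, with `C`
depending on the decay constants of `u₀, Du₀, D²u₀` and `ν ≥ 0`. [folklore] -/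
theorem norm_rampForce_le {u₀ : EuclideanSpace ℝ (Fin 3) → EuclideanSpace ℝ (Fin 3)}
    (hu₀s : ContDiff ℝ ∞ u₀) (hu₀ : HasRapidSpatialDecay u₀) {ν : ℝ} (hν : 0 ≤ ν) :
    ∃ C : ℝ, 0 ≤ C ∧ ∀ s ∈ Icc (0 : ℝ) 1, ∀ x : EuclideanSpace ℝ (Fin 3),
      ‖timeDerivWithin (Icc 0 1) (fun (s : ℝ) (x : EuclideanSpace ℝ (Fin 3)) => s • u₀ x) s x +
          convect (fun y => s • u₀ y) (fun y => s • u₀ y) x - ν • (Δ (fun y => s • u₀ y)) x‖ ≤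
        C * ((1 + ‖x‖) ^ 2)⁻¹ := by
  obtain ⟨C00, h00⟩ := hu₀ 0 0
  obtain ⟨C02, h02⟩ := hu₀ 0 2
  obtain ⟨C12, h12⟩ := hu₀ 1 2
  obtain ⟨C22, h22⟩ := hu₀ 2 2
  have hC00 : 0 ≤ C00 := le_trans (by positivity) (h00 0)
  have hC02 : 0 ≤ C02 := le_trans (by positivity) (h02 0)
  have hC12 : 0 ≤ C12 := le_trans (by positivity) (h12 0)
  have hC22 : 0 ≤ C22 := le_trans (by positivity) (h22 0)
  refine ⟨C02 + C12 * C00 + ν * (3 * C22), by positivity, fun s hs x => ?_⟩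
  have hw : 0 < (1 + ‖x‖) ^ 2 := by positivity
  have hd : DifferentiableAt ℝ u₀ x := (hu₀s.differentiable (by simp)).differentiableAt
  have hs1 : |s| ≤ 1 := abs_le.2 ⟨by linarith [hs.1], hs.2⟩
  -- the three terms
  rw [timeDerivWithin_ramp u₀ hs x]
  have hT2 : ‖convect (fun y => s • u₀ y) (fun y => s • u₀ y) x‖ ≤ ‖fderiv ℝ u₀ x‖ * ‖u₀ x‖ := by
    unfold convect
    rw [fderiv_fun_const_smul hd s]
    simp only [FunLike.coe_smul, Pi.smul_apply, map_smul]
    rw [norm_smul, norm_smul, Real.norm_eq_abs]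
    calc |s| * (|s| * ‖fderiv ℝ u₀ x (u₀ x)‖) ≤ 1 * (1 * ‖fderiv ℝ u₀ x (u₀ x)‖) := by
          gcongr
      _ = ‖fderiv ℝ u₀ x (u₀ x)‖ := by ring
      _ ≤ ‖fderiv ℝ u₀ x‖ * ‖u₀ x‖ := ContinuousLinearMap.le_opNorm _ _
  have hT3 : ‖ν • (Δ (fun y => s • u₀ y)) x‖ ≤ ν * (3 * ‖iteratedFDeriv ℝ 2 u₀ x‖) := by
    have hΔ : (Δ (fun y => s • u₀ y)) x = s • (Δ u₀) x :=
      laplacian_smul s (hu₀s.contDiffAt.of_le (by norm_cast))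
    rw [hΔ, norm_smul, norm_smul, Real.norm_eq_abs, Real.norm_eq_abs, abs_of_nonneg hν]
    calc ν * (|s| * ‖(Δ u₀) x‖) ≤ ν * (1 * (3 * ‖iteratedFDeriv ℝ 2 u₀ x‖)) := by
          gcongr
          exact norm_laplacian_le_three_mul u₀ x
      _ = ν * (3 * ‖iteratedFDeriv ℝ 2 u₀ x‖) := by ring
  -- the decay bounds
  have h1 : (1 + ‖x‖) ^ 2 * ‖u₀ x‖ ≤ C02 := by
    have := h02 x; rwa [norm_iteratedFDeriv_zero] at this
  have h2 : ‖u₀ x‖ ≤ C00 := by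
    have := h00 x; rwa [pow_zero, one_mul, norm_iteratedFDeriv_zero] at this
  have h3 : (1 + ‖x‖) ^ 2 * ‖fderiv ℝ u₀ x‖ ≤ C12 := by
    have := h12 x
    rwa [← norm_iteratedFDeriv_fderiv, norm_iteratedFDeriv_zero] at this
  have h4 : (1 + ‖x‖) ^ 2 * ‖iteratedFDeriv ℝ 2 u₀ x‖ ≤ C22 := h22 x
  -- assemble (atoms generalised so that `linarith` never unfolds `Δ`, `Dⁿ`)
  rw [← div_eq_mul_inv, le_div_iff₀ hw]
  have hnorm : ‖u₀ x + convect (fun y => s • u₀ y) (fun y => s • u₀ y) x -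
      ν • (Δ (fun y => s • u₀ y)) x‖ ≤
      ‖u₀ x‖ + ‖fderiv ℝ u₀ x‖ * ‖u₀ x‖ + ν * (3 * ‖iteratedFDeriv ℝ 2 u₀ x‖) :=
    (norm_sub_le _ _).trans (add_le_add ((norm_add_le _ _).trans (add_le_add le_rfl hT2)) hT3)
  have hA0 : 0 ≤ ‖u₀ x‖ := norm_nonneg _
  generalize ‖u₀ x + convect (fun y => s • u₀ y) (fun y => s • u₀ y) x -
      ν • (Δ (fun y => s • u₀ y)) x‖ = N at hnorm ⊢
  generalize ‖u₀ x‖ = A at h1 h2 hnorm hA0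
  generalize ‖fderiv ℝ u₀ x‖ = B at h3 hnorm
  generalize ‖iteratedFDeriv ℝ 2 u₀ x‖ = D at h4 hnorm
  generalize (1 + ‖x‖) ^ 2 = W at hw h1 h3 h4 ⊢
  have e1 : N * W ≤ (A + B * A + ν * (3 * D)) * W := mul_le_mul_of_nonneg_right hnorm hw.le
  have e2 : W * B * A ≤ C12 * C00 := mul_le_mul h3 h2 hA0 hC12
  have e3 : ν * (3 * (W * D)) ≤ ν * (3 * C22) := by gcongr
  have e4 : (A + B * A + ν * (3 * D)) * W = W * A + W * B * A + ν * (3 * (W * D)) := by ring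
  linarith [e1, e2, e3, e4, h1]

/-- **Finite action of the ramp force**: `∫₀¹ ∫ |g|² < ∞`. [folklore] -/
theorem lintegral_eEnergy_rampForce_lt_top
    {u₀ : EuclideanSpace ℝ (Fin 3) → EuclideanSpace ℝ (Fin 3)}
    (hu₀s : ContDiff ℝ ∞ u₀) (hu₀ : HasRapidSpatialDecay u₀) {ν : ℝ} (hν : 0 ≤ ν) :
    (∫⁻ s in Icc (0 : ℝ) 1, eEnergy (fun x : EuclideanSpace ℝ (Fin 3) =>
      timeDerivWithin (Icc 0 1) (fun (s : ℝ) (x : EuclideanSpace ℝ (Fin 3)) => s • u₀ x) s x +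
        convect (fun y => s • u₀ y) (fun y => s • u₀ y) x - ν • (Δ (fun y => s • u₀ y)) x)) < ⊤ := by
  obtain ⟨C, hC0, hC⟩ := norm_rampForce_le hu₀s hu₀ hν
  set G : ℝ → EuclideanSpace ℝ (Fin 3) → EuclideanSpace ℝ (Fin 3) := fun s x =>
    timeDerivWithin (Icc 0 1) (fun (s : ℝ) (x : EuclideanSpace ℝ (Fin 3)) => s • u₀ x) s x +
      convect (fun y => s • u₀ y) (fun y => s • u₀ y) x - ν • (Δ (fun y => s • u₀ y)) x with hG
  have hC' : ∀ s ∈ Icc (0 : ℝ) 1, ∀ x, ‖G s x‖ ≤ C * ((1 + ‖x‖) ^ 2)⁻¹ := fun s hs x => by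
    rw [hG]; exact hC s hs x
  set I : ℝ≥0∞ := ∫⁻ x : EuclideanSpace ℝ (Fin 3), ENNReal.ofReal ((1 + ‖x‖) ^ (-(4 : ℝ))) with hI
  have hIfin : I < ⊤ := by
    refine finite_integral_one_add_norm ?_
    rw [finrank_euclideanSpace_fin]; norm_num
  -- pointwise bound of the energy density
  have hpt : ∀ s ∈ Icc (0 : ℝ) 1, ∀ x : EuclideanSpace ℝ (Fin 3),
      ‖G s x‖ₑ ^ 2 ≤ ENNReal.ofReal (C ^ 2) * ENNReal.ofReal ((1 + ‖x‖) ^ (-(4 : ℝ))) := by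
    intro s hs x
    have h := hC' s hs x
    have hw : 0 < 1 + ‖x‖ := by positivity
    rw [← ofReal_norm, ← ENNReal.ofReal_pow (norm_nonneg _), ← ENNReal.ofReal_mul (sq_nonneg _)]
    refine ENNReal.ofReal_le_ofReal ?_
    have hsq := pow_le_pow_left₀ (norm_nonneg _) h 2
    have heq : (C * ((1 + ‖x‖) ^ 2)⁻¹) ^ 2 = C ^ 2 * (1 + ‖x‖) ^ (-(4 : ℝ)) := by
      rw [mul_pow, inv_pow, ← pow_mul, Real.rpow_neg hw.le,
        show (4 : ℝ) = ((4 : ℕ) : ℝ) by norm_num, Real.rpow_natCast]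
    rw [heq] at hsq
    exact hsq
  -- slice energies
  have hslice : ∀ s ∈ Icc (0 : ℝ) 1, eEnergy (G s) ≤ ENNReal.ofReal (C ^ 2) * I := by
    intro s hs
    unfold eEnergy
    calc ∫⁻ x, ‖G s x‖ₑ ^ 2 ≤ ∫⁻ x : EuclideanSpace ℝ (Fin 3),
          ENNReal.ofReal (C ^ 2) * ENNReal.ofReal ((1 + ‖x‖) ^ (-(4 : ℝ))) :=
          lintegral_mono (hpt s hs)
      _ = ENNReal.ofReal (C ^ 2) * I := by rw [lintegral_const_mul' _ _ ENNReal.ofReal_ne_top]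
  have hmono : (∫⁻ s in Icc (0 : ℝ) 1, eEnergy (G s)) ≤
      ∫⁻ _s in Icc (0 : ℝ) 1, ENNReal.ofReal (C ^ 2) * I :=
    setLIntegral_mono' measurableSet_Icc fun s hs => hslice s hs
  refine lt_of_le_of_lt hmono ?_
  rw [setLIntegral_const, Real.volume_Icc, sub_zero, ENNReal.ofReal_one, mul_one]
  exact ENNReal.mul_lt_top ENNReal.ofReal_lt_top hIfin

/-! ### The item -/

/-- **Item stmt-NavierStokesRegularity-1447** (`QuasipotentialCoercivity.ReachableAlongFlow`): every
slice `u t`, `t < T`, is reachable with horizon `τ = 1 + T` and the action of the linear ramp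
`s ↦ s • u 0` on `[0, 1]`, the tail being the solution itself. [this file] -/
theorem quasipotentialCoercivity_reachableAlongFlow_proof :
    Summit.NavierStokesRegularity.NavierStokesRegularity.Theses.QuasipotentialCoercivity.ReachableAlongFlow := by
  unfold Summit.NavierStokesRegularity.NavierStokesRegularity.Theses.QuasipotentialCoercivity.ReachableAlongFlow
  intro ν T hν hT u p hcl hLH hdec
  have h0 : (0 : ℝ) ∈ Ico 0 T := ⟨le_rfl, hT⟩
  have hu₀s : ContDiff ℝ ∞ (u 0) := hcl.contDiff_velocity h0
  have hdiv₀ : VectorCalculus.IsDivFree (u 0) := hcl.divFree 0 h0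
  have hfin := lintegral_eEnergy_rampForce_lt_top hu₀s hdec hν.le
  refine ⟨1 + T, (∫⁻ s in Icc (0 : ℝ) 1, eEnergy (fun x : EuclideanSpace ℝ (Fin 3) =>
      timeDerivWithin (Icc 0 1) (fun (s : ℝ) (x : EuclideanSpace ℝ (Fin 3)) => s • u 0 x) s x +
        convect (fun y => s • u 0 y) (fun y => s • u 0 y) x - ν • (Δ (fun y => s • u 0 y)) x)).toNNReal,
    by linarith, fun t ht => ?_⟩
  refine ⟨1, t, fun s x => s • u 0 x, fun _ _ => (0 : ℝ),
    fun s x => timeDerivWithin (Icc 0 1) (fun (s : ℝ) (x : EuclideanSpace ℝ (Fin 3)) => s • u 0 x) s x +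
      convect (fun y => s • u 0 y) (fun y => s • u 0 y) x - ν • (Δ (fun y => s • u 0 y)) x,
    ⟨one_pos, isClassicalNSSolutionOn_ramp hu₀s hdiv₀ ν, hasUniformRapidDecayOn_ramp hu₀s hdec one_pos,
      ?_, ?_⟩, ⟨ht.1, by linarith [ht.2], T, u, p, ht.2, hcl, ?_, ?_, rfl⟩⟩
  · funext x
    exact zero_smul ℝ (u 0 x)
  · exact (ENNReal.coe_toNNReal hfin.ne).ge
  · have h1 : (fun x => (1 : ℝ) • u 0 x) = u 0 := funext fun x => one_smul ℝ (u 0 x)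
    show IsLerayHopfOn T ν 0 (fun x => (1 : ℝ) • u 0 x) u
    rw [h1]
    exact hLH
  · show u 0 = fun x => (1 : ℝ) • u 0 x
    funext x
    exact (one_smul ℝ (u 0 x)).symm

end Summit.NavierStokesRegularity.NavierStokesRegularity.Theorems

end
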